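import Literature.Analysis.FluidPDE.KwonDecompositionMomentum
import Literature.Analysis.FluidPDE.KwonDriftBounds
import HarnessLib

/-!
# Kwon's Lemma 2.5: the classes of the decomposition `u = v + h`

Analysis/FluidPDE file on the discharge path of the named fact
`Literature.Analysis.FluidPDE.kwon2023_velocity_epsilon_regularity`
(`PressureFreeEpsilonRegularity.lean`; H. Kwon, J. Differential Equations (2023) =
arXiv:2104.03160, Thm. 1.4), thirteenth brick of Lemma 2.5. PRINTED (arXiv p. 7): "for any
dissipative weak solution `u` to (NS) in `Q₂`, we can decompose `u = v + h` in `(−4,0) × B₁` such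
that `h` is harmonic in `(−4,0) × B₁` … `v` solves the perturbed Navier–Stokes equations … in
`(−4,0) × B₁` in the sense of distributions and satisfies the local energy inequality", i.e. `(v,q)`
is a suitable weak solution of (per.NS) with drift `h` in the sense of Def. 2.4
(`Kwon2023.IsPerturbedSuitableOn`). With `W` the good representative of `u`
(`exists_isGoodVelocity`), `h = H(W(t))` (`driftField`), `∇h = driftGrad W`, `v = W − h`, this
file records the CLASS clauses of Def. 2.4 that need no further estimate, on any open
`O ⊆ (−4,0) × B₁`:

* `hasWeakSpatialGradientOn_driftField` — the `drift` clause: `driftGrad W` is a weak spatial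
  gradient of the drift (slice-wise integration by parts for the smooth slices; no continuity
  in time is needed);
* `driftClass_driftField` — `h ∈ L²_t L^∞_x(O)` (the drift is bounded on space–time,
  `exists_norm_driftField_le_const`, and `O` has bounded time range; the parabolic-cylinder
  case is also `lintegral_eLpNorm_indicator_driftField_sq_lt_top` of `KwonDriftBounds`);
* `energyClass_sub_driftField` — `v ∈ L^∞_t L²_x(O)` (`|v|² ≤ 2|W|² + 2|h|²`, the uniform
  `L²` bound of the slices of `W` and the bound of `h` on `B₁`);
* `ae_eq_add_driftField` — `u = v + h` a.e. on `Q₁(0)` (indeed on `Q₂(0)`);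
* `aestronglyMeasurable_pressureField/forceField_restrict`, `locallyIntegrableOn(_sq)_of_eq_sub_driftField`
  — the measurability / local integrability clauses in the literal form of the structure fields.

Together with `KwonDecompositionMomentum.lean` (`momentum`, `divFree`, `drift_divFree`) this
leaves, for Def. 2.4 on `Q₁(0)`: the `pressure`/`forceClass` integrability (Kwon's (est.q),
(est.f)), `force_divFree`, and the local energy inequality (p. 9). No NS-regularity statement
is touched.

## Mathlib / tree search

Tree (reused): `exists_forall_norm_driftGrad_le`, `eLpNorm_driftField_top_lt_top` (the bound
`h ∈ L^∞`, not restated here) (`KwonDriftBounds`); `exists_norm_driftField_le_const`, `locallyIntegrable_driftField(_sq)`,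
`locallyIntegrable_sub_driftField(_sq)`, `coe_kwonCyl_two_eq_parabolicCylinder`
(`KwonDecompositionMomentum`); `driftGrad`,
`stronglyMeasurable_uncurry_driftGrad/pressureField/forceField`, `contDiff_driftField`,
`IsGoodVelocity.sq_le_uniform` (`KwonSpaceTimeFields`); `integral_fderiv_apply_eq_zero`
(`WholeSpaceIBP`); `IsSpaceTimeTestOn.hasCompactSupport_slice` (`ClassicalSolutionCalculus`).
Mathlib: `memLp_top_of_bound`, `eLpNormEssSup_le_of_ae_bound`, `fderiv_mul`, `fderiv_inner_apply`,
`ofReal_integral_eq_lintegral_ofReal`, `lintegral_indicator`, `setLIntegral_const`.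

## References

* H. Kwon, *The role of the pressure in the regularity theory for the Navier–Stokes equations*,
  J. Differential Equations 357 (2023) = arXiv:2104.03160: Lemma 2.5 (p. 7), its proof
  (pp. 8–9), Def. 2.4, Remark 2.3 (est.h). [Kwon2023RolePressure]
-/

noncomputable section

open MeasureTheory Set Function Filter Topology TopologicalSpace Metric InnerProductSpace
  ContinuousLinearMap
open scoped NNReal ENNReal RealInnerProductSpace Convolution Laplacian ContDiff

namespace Literature.Analysis.FluidPDE

namespace Kwon2023

variable {W u v h f : ℝ → EuclideanSpace ℝ (Fin 3) → EuclideanSpace ℝ (Fin 3)}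
  {Dh : ℝ → EuclideanSpace ℝ (Fin 3) → EuclideanSpace ℝ (Fin 3) →L[ℝ] EuclideanSpace ℝ (Fin 3)}
  {q P : ℝ → EuclideanSpace ℝ (Fin 3) → ℝ} {O : Opens (ℝ × EuclideanSpace ℝ (Fin 3))}

/-! ### The drift gradient -/

/-- The drift gradient is locally integrable on space–time (bounded and jointly measurable).
[cite: Kwon2023RolePressure, Lemma 2.5 with Remark 2.3 (est.h)] -/
theorem locallyIntegrable_driftGrad (hW : IsGoodVelocity W) :
    LocallyIntegrable (uncurry (driftGrad W)) volume := by
  obtain ⟨M, hM⟩ := exists_forall_norm_driftGrad_le hW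
  exact (memLp_top_of_bound (stronglyMeasurable_uncurry_driftGrad hW).aestronglyMeasurable M
    (Eventually.of_forall fun z => hM z.1 z.2)).locallyIntegrable le_top

/-- **The `drift` clause of Def. 2.4**: `∇h = driftGrad W` is a weak spatial gradient of the
drift `h = H(W)` on every open space–time region (each slice is smooth with classical derivative
`driftGrad W t`; integration by parts in `x` slice by slice, no boundary terms).
[cite: Kwon2023RolePressure, Lemma 2.5 with Def. 2.4] -/
theorem hasWeakSpatialGradientOn_driftField (hW : IsGoodVelocity W)
    (hh : ∀ t x, h t x = driftField W t x) (hDh : ∀ t x, Dh t x = driftGrad W t x) :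
    HasWeakSpatialGradientOn O h Dh where
  locallyIntegrableOn := by
    rw [show uncurry h = uncurry (driftField W) from funext fun z => hh z.1 z.2]
    exact (locallyIntegrable_driftField hW).locallyIntegrableOn _
  locallyIntegrableOn_grad := by
    rw [show uncurry Dh = uncurry (driftGrad W) from funext fun z => hDh z.1 z.2]
    exact (locallyIntegrable_driftGrad hW).locallyIntegrableOn _
  integral_fderiv_mul_inner_eq φ hφ a w := by
    rw [← integral_neg]
    refine integral_congr_ae (Eventually.of_forall fun t => ?_)
    dsimp only
    have eht : h t = driftField W t := funext (hh t)
    have hφ1 : ContDiff ℝ 1 (φ t) := contDiff_infty.1 (hφ.contDiff_slice t) 1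
    have hφc : HasCompactSupport (φ t) := hφ.hasCompactSupport_slice t
    have hh1 : ContDiff ℝ 1 (h t) := by rw [eht]; exact contDiff_driftField hW t
    have hdφ : ∀ x, DifferentiableAt ℝ (φ t) x := fun x => hφ1.differentiable one_ne_zero x
    have hdh : ∀ x, DifferentiableAt ℝ (h t) x := fun x => hh1.differentiable one_ne_zero x
    have hfd : ∀ x, fderiv ℝ (h t) x = Dh t x := fun x => by rw [hDh, eht]; rfl
    -- the slice product `g = φ(t) ⟪h(t), w⟫` and its directional derivative
    have hk1 : ContDiff ℝ 1 fun x => ⟪h t x, w⟫ := hh1.inner ℝ contDiff_const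
    have hg1 : ContDiff ℝ 1 fun x => φ t x * ⟪h t x, w⟫ := hφ1.mul hk1
    have hgc : HasCompactSupport fun x => φ t x * ⟪h t x, w⟫ := hφc.mul_right
    have h0 := integral_fderiv_apply_eq_zero hg1 hgc a
    have hD : ∀ x, fderiv ℝ (fun x => φ t x * ⟪h t x, w⟫) x a =
        fderiv ℝ (φ t) x a * ⟪h t x, w⟫ + φ t x * ⟪Dh t x a, w⟫ := by
      intro x
      have hdk : DifferentiableAt ℝ (fun x => ⟪h t x, w⟫) x := hk1.differentiable one_ne_zero x
      rw [fderiv_fun_mul (hdφ x) hdk]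
      simp only [_root_.add_apply, _root_.smul_apply, smul_eq_mul]
      rw [fderiv_inner_apply ℝ (hdh x) (differentiableAt_const w),
        fderiv_fun_const, hfd x]
      simp only [Pi.zero_apply, _root_.zero_apply, inner_zero_right, zero_add]
      ring
    have iA : Integrable fun x => fderiv ℝ (φ t) x a * ⟪h t x, w⟫ :=
      (((hφ1.continuous_fderiv one_ne_zero).clm_apply continuous_const).mul hk1.continuous)
        |>.integrable_of_hasCompactSupport ((hφc.fderiv_apply (𝕜 := ℝ) a).mul_right)
    have iB : Integrable fun x => φ t x * ⟪Dh t x a, w⟫ := by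
      have hc : Continuous fun x => ⟪Dh t x a, w⟫ := by
        have e : (fun x => ⟪Dh t x a, w⟫) = fun x => ⟪fderiv ℝ (h t) x a, w⟫ := by
          funext x; rw [hfd x]
        rw [e]
        exact ((hh1.continuous_fderiv one_ne_zero).clm_apply continuous_const).inner continuous_const
      exact (hφ1.continuous.mul hc).integrable_of_hasCompactSupport hφc.mul_right
    simp_rw [hD] at h0
    rw [integral_add iA iB] at h0
    linarith

/-! ### `h ∈ L²_t L^∞_x`, `h ∈ L^∞`, `v ∈ L^∞_t L²_x` -/

/-- **The `driftClass` clause of Def. 2.4** on `O ⊆ (−4,0) × B₁`: `h ∈ L²_t L^∞_x(O)` (the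
drift is bounded on space–time and `O` has time range in `(−4,0)`).
[cite: Kwon2023RolePressure, Lemma 2.5 with Def. 2.4 and Remark 2.3 (est.h)] -/
theorem driftClass_driftField (hW : IsGoodVelocity W) (hO : O ≤ kwonCyl (-4) 0 1)
    (hh : ∀ t x, h t x = driftField W t x) :
    ∫⁻ t, eLpNorm (fun x => (O : Set (ℝ × EuclideanSpace ℝ (Fin 3))).indicator (uncurry h) (t, x))
      (⊤ : ℝ≥0∞) (volume : Measure (EuclideanSpace ℝ (Fin 3))) ^ (2 : ℕ) < ⊤ := by
  obtain ⟨M, hM0, hM⟩ := exists_norm_driftField_le_const hW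
  have hle : ∀ t, eLpNorm (fun x => (O : Set (ℝ × EuclideanSpace ℝ (Fin 3))).indicator
      (uncurry h) (t, x)) (⊤ : ℝ≥0∞) (volume : Measure (EuclideanSpace ℝ (Fin 3))) ≤
        (Ioo (-4 : ℝ) 0).indicator (fun _ => ENNReal.ofReal M) t := by
    intro t
    by_cases ht : t ∈ Ioo (-4 : ℝ) 0
    · rw [indicator_of_mem ht, eLpNorm_exponent_top]
      refine eLpNormEssSup_le_of_ae_bound (Eventually.of_forall fun x => ?_)
      refine (norm_indicator_le_norm_self _ _).trans ?_
      show ‖h t x‖ ≤ M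
      rw [hh]; exact hM t x
    · rw [indicator_of_notMem ht]
      have e : (fun x => (O : Set (ℝ × EuclideanSpace ℝ (Fin 3))).indicator (uncurry h) (t, x)) =
          fun _ => 0 := funext fun x => indicator_of_notMem (fun hz => ht (hO hz).1) _
      rw [e, eLpNorm_zero']
  have hmono : ∫⁻ t, eLpNorm (fun x => (O : Set (ℝ × EuclideanSpace ℝ (Fin 3))).indicator
      (uncurry h) (t, x)) (⊤ : ℝ≥0∞) (volume : Measure (EuclideanSpace ℝ (Fin 3))) ^ (2 : ℕ) ≤
        ∫⁻ t, (Ioo (-4 : ℝ) 0).indicator (fun _ => ENNReal.ofReal M ^ (2 : ℕ)) t := by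
    refine lintegral_mono fun t => ?_
    have h1 := hle t
    by_cases ht : t ∈ Ioo (-4 : ℝ) 0
    · rw [indicator_of_mem ht] at h1 ⊢
      exact pow_le_pow_left' h1 2
    · rw [indicator_of_notMem ht] at h1 ⊢
      rw [nonpos_iff_eq_zero.1 h1, zero_pow two_ne_zero]
  refine lt_of_le_of_lt hmono ?_
  rw [lintegral_indicator measurableSet_Ioo, setLIntegral_const, Real.volume_Ioo]
  exact ENNReal.mul_lt_top (ENNReal.pow_lt_top ENNReal.ofReal_lt_top) ENNReal.ofReal_lt_top

/-- The slices of a good velocity have `∫⁻ ‖W(t)‖ₑ² ≤ A` for a uniform `A` (the uniform real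
bound `sq_le_uniform` in `ℝ≥0∞` form). [cite: Kwon2023RolePressure, Def. 1.1 (u ∈ L^∞_t L²_x)] -/
theorem IsGoodVelocity.exists_lintegral_enorm_sq_le (hW : IsGoodVelocity W) :
    ∃ A : ℝ, ∀ t, ∫⁻ x, ‖W t x‖ₑ ^ 2 ≤ ENNReal.ofReal A := by
  obtain ⟨A, hA⟩ := hW.sq_le_uniform
  refine ⟨A, fun t => ?_⟩
  have e : ∫⁻ x, ‖W t x‖ₑ ^ 2 = ∫⁻ x, ENNReal.ofReal (‖W t x‖ ^ 2) :=
    lintegral_congr_ae (Eventually.of_forall fun x => by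
      dsimp only
      rw [← ofReal_norm, ENNReal.ofReal_pow (norm_nonneg _)])
  rw [e, ← ofReal_integral_eq_lintegral_ofReal (hW.integrable_sq t)
    (Eventually.of_forall fun x => by positivity)]
  exact ENNReal.ofReal_le_ofReal (hA t)

/-- **The `energyClass` clause of Def. 2.4** on `O ⊆ (−4,0) × B₁`: `v = W − h ∈ L^∞_t L²_x(O)`
(`|v|² ≤ 2|W|² + 2|h|²`, the uniform `L²` bound of the slices of `W`, the bound of `h`, and
`O(t) ⊆ B₁`). [cite: Kwon2023RolePressure, Lemma 2.5 with Def. 2.4] -/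
theorem energyClass_sub_driftField (hW : IsGoodVelocity W) (hO : O ≤ kwonCyl (-4) 0 1)
    (hv : ∀ t x, v t x = W t x - driftField W t x) :
    ∃ C : ℝ≥0, ∀ᵐ t : ℝ, ∫⁻ x, (O : Set (ℝ × EuclideanSpace ℝ (Fin 3))).indicator
      (fun z : ℝ × EuclideanSpace ℝ (Fin 3) => ‖v z.1 z.2‖ₑ ^ 2) (t, x) ≤ C := by
  obtain ⟨M, hM0, hM⟩ := exists_norm_driftField_le_const hW
  obtain ⟨A, hA⟩ := hW.exists_lintegral_enorm_sq_le
  set B : ℝ≥0∞ := 2 * ENNReal.ofReal A +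
    2 * (ENNReal.ofReal (M ^ 2) * volume (ball (0 : EuclideanSpace ℝ (Fin 3)) 1)) with hB
  have hBtop : B ≠ ⊤ := by
    refine ENNReal.add_ne_top.2 ⟨ENNReal.mul_ne_top (by norm_num) ENNReal.ofReal_ne_top,
      ENNReal.mul_ne_top (by norm_num) (ENNReal.mul_ne_top ENNReal.ofReal_ne_top
        measure_ball_lt_top.ne)⟩
  refine ⟨B.toNNReal, Eventually.of_forall fun t => ?_⟩
  rw [ENNReal.coe_toNNReal hBtop]
  -- pointwise bound of the indicator
  have hpt : ∀ x, (O : Set (ℝ × EuclideanSpace ℝ (Fin 3))).indicator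
      (fun z : ℝ × EuclideanSpace ℝ (Fin 3) => ‖v z.1 z.2‖ₑ ^ 2) (t, x) ≤
        2 * ‖W t x‖ₑ ^ 2 + 2 * (ball (0 : EuclideanSpace ℝ (Fin 3)) 1).indicator
          (fun _ => ENNReal.ofReal (M ^ 2)) x := by
    intro x
    by_cases hz : ((t, x) : ℝ × EuclideanSpace ℝ (Fin 3)) ∈ (O : Set (ℝ × EuclideanSpace ℝ (Fin 3)))
    · have hx : x ∈ ball (0 : EuclideanSpace ℝ (Fin 3)) 1 := (hO hz).2
      rw [indicator_of_mem hz, indicator_of_mem hx]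
      dsimp only
      have hreal : ‖v t x‖ ^ 2 ≤ 2 * ‖W t x‖ ^ 2 + 2 * M ^ 2 := by
        rw [hv]
        have h1 : ‖W t x - driftField W t x‖ ≤ ‖W t x‖ + ‖driftField W t x‖ := norm_sub_le _ _
        have h2 := hM t x
        have h3 : 0 ≤ ‖W t x - driftField W t x‖ := norm_nonneg _
        nlinarith [mul_le_mul h1 h1 h3 (by positivity), norm_nonneg (driftField W t x),
          sq_nonneg (‖W t x‖ - ‖driftField W t x‖), mul_le_mul h2 h2 (norm_nonneg _) hM0]
      calc ‖v t x‖ₑ ^ 2 = ENNReal.ofReal (‖v t x‖ ^ 2) := by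
            rw [← ofReal_norm, ENNReal.ofReal_pow (norm_nonneg _)]
        _ ≤ ENNReal.ofReal (2 * ‖W t x‖ ^ 2 + 2 * M ^ 2) := ENNReal.ofReal_le_ofReal hreal
        _ = 2 * ‖W t x‖ₑ ^ 2 + 2 * ENNReal.ofReal (M ^ 2) := by
            rw [ENNReal.ofReal_add (by positivity) (by positivity),
              ENNReal.ofReal_mul zero_le_two, ENNReal.ofReal_mul zero_le_two,
              ENNReal.ofReal_pow (norm_nonneg _), ofReal_norm, ENNReal.ofReal_ofNat]
    · rw [indicator_of_notMem hz]
      exact bot_le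
  have hmeas : Measurable fun x => 2 * ‖W t x‖ₑ ^ 2 :=
    ((hW.stronglyMeasurable_slice t).measurable.enorm.pow_const 2).const_mul 2
  calc ∫⁻ x, (O : Set (ℝ × EuclideanSpace ℝ (Fin 3))).indicator
        (fun z : ℝ × EuclideanSpace ℝ (Fin 3) => ‖v z.1 z.2‖ₑ ^ 2) (t, x)
      ≤ ∫⁻ x, (2 * ‖W t x‖ₑ ^ 2 + 2 * (ball (0 : EuclideanSpace ℝ (Fin 3)) 1).indicator
          (fun _ => ENNReal.ofReal (M ^ 2)) x) := lintegral_mono hpt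
    _ = 2 * (∫⁻ x, ‖W t x‖ₑ ^ 2) +
          2 * (ENNReal.ofReal (M ^ 2) * volume (ball (0 : EuclideanSpace ℝ (Fin 3)) 1)) := by
        rw [lintegral_add_left hmeas, lintegral_const_mul _
            ((hW.stronglyMeasurable_slice t).measurable.enorm.pow_const 2),
          lintegral_const_mul _ (measurable_const.indicator measurableSet_ball),
          lintegral_indicator measurableSet_ball, setLIntegral_const]
    _ ≤ B := by
        rw [hB]
        gcongr
        exact hA t

/-! ### The decomposition and the measurability clauses -/

/-- **`u = v + h` a.e. on `Q₁(0)`** (indeed on `Q₂(0)`, where `W = u` a.e. and `v + h = W`).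
[cite: Kwon2023RolePressure, Lemma 2.5] -/
theorem ae_eq_add_driftField
    (hWu : uncurry W =ᵐ[volume] (parabolicCylinder 2 (0 : ℝ × EuclideanSpace ℝ (Fin 3))).indicator (uncurry u))
    (hv : ∀ t x, v t x = W t x - driftField W t x) (hh : ∀ t x, h t x = driftField W t x) :
    ∀ᵐ z : ℝ × EuclideanSpace ℝ (Fin 3) ∂(volume.restrict
      (parabolicCylinder 1 (0 : ℝ × EuclideanSpace ℝ (Fin 3)))), u z.1 z.2 = v z.1 z.2 + h z.1 z.2 := by
  have hsub : parabolicCylinder 1 (0 : ℝ × EuclideanSpace ℝ (Fin 3)) ⊆ parabolicCylinder 2 0 := by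
    intro z hz
    rw [mem_parabolicCylinder] at hz ⊢
    exact ⟨⟨by linarith [hz.1.1], hz.1.2⟩, hz.2.trans (by norm_num)⟩
  filter_upwards [ae_restrict_mem (isOpen_parabolicCylinder 1 _).measurableSet,
    ae_restrict_of_ae hWu] with z hz hWz
  rw [indicator_of_mem (hsub hz)] at hWz
  rw [hv, hh, sub_add_cancel]
  exact hWz.symm

/-- The `locallyIntegrableOn` clause of Def. 2.4 for `v = W − h`. [cite: Kwon2023RolePressure, Lemma 2.5 with Def. 2.4] -/
theorem locallyIntegrableOn_of_eq_sub_driftField (hW : IsGoodVelocity W)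
    (hv : ∀ t x, v t x = W t x - driftField W t x) (S : Set (ℝ × EuclideanSpace ℝ (Fin 3))) :
    LocallyIntegrableOn (uncurry v) S volume := by
  rw [show uncurry v = uncurry fun t x => W t x - driftField W t x from funext fun z => hv z.1 z.2]
  exact (locallyIntegrable_sub_driftField hW).locallyIntegrableOn _

/-- The `locallyIntegrableOn_sq` clause of Def. 2.4 for `v = W − h`. [cite: Kwon2023RolePressure, Lemma 2.5 with Def. 2.4] -/
theorem locallyIntegrableOn_sq_of_eq_sub_driftField (hW : IsGoodVelocity W)
    (hv : ∀ t x, v t x = W t x - driftField W t x) (S : Set (ℝ × EuclideanSpace ℝ (Fin 3))) :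
    LocallyIntegrableOn (fun z => ‖uncurry v z‖ ^ 2) S volume := by
  rw [show uncurry v = uncurry fun t x => W t x - driftField W t x from funext fun z => hv z.1 z.2]
  exact (locallyIntegrable_sub_driftField_sq hW).locallyIntegrableOn _

/-- The `aestronglyMeasurable_pressure` clause of Def. 2.4 for `q = pressureField W P`
(a jointly measurable Riesz representative `P`). [cite: Kwon2023RolePressure, Lemma 2.5 with Def. 2.4] -/
theorem aestronglyMeasurable_of_eq_pressureField (hW : IsGoodVelocity W)
    (hPm : StronglyMeasurable (uncurry P)) (hq : ∀ t x, q t x = pressureField W P t x)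
    (μ : Measure (ℝ × EuclideanSpace ℝ (Fin 3))) : AEStronglyMeasurable (uncurry q) μ := by
  rw [show uncurry q = uncurry (pressureField W P) from funext fun z => hq z.1 z.2]
  exact (stronglyMeasurable_uncurry_pressureField hW hPm).aestronglyMeasurable

/-- The `aestronglyMeasurable_force` clause of Def. 2.4 for `f = forceField W`. [cite: Kwon2023RolePressure, Lemma 2.5 with Def. 2.4] -/
theorem aestronglyMeasurable_of_eq_forceField (hW : IsGoodVelocity W)
    (hf : ∀ t x, f t x = forceField W t x) (μ : Measure (ℝ × EuclideanSpace ℝ (Fin 3))) :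
    AEStronglyMeasurable (uncurry f) μ := by
  rw [show uncurry f = uncurry (forceField W) from funext fun z => hf z.1 z.2]
  exact (stronglyMeasurable_uncurry_forceField hW).aestronglyMeasurable

end Kwon2023

end Literature.Analysis.FluidPDE

end
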